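import Summits.AtomisticToContinuum.FouriersLaw.Theorems.JunctionLocalityNonBallisticDrudeLineDefs
import Summits.AtomisticToContinuum.FouriersLaw.Theorems.BondHeatUncertaintyLinearResponseFTUREquilibriumBondHeatVariance

/-!
# Stub `stub_equilibriumTimeIntegratedCurrentVariance` of line `drude-controls-conductance` (R1) — crux
`JunctionLocality.NonBallistic` (stmt-AtomisticToContinuum-9127)

The registered stub `stub_equilibriumTimeIntegratedCurrentVariance` (= `DrudeLine.EquilibriumTimeIntegratedCurrentVariance`,
part 2 of the lead's split of the lever) is proved below, sorry-free, from tree facts only (no neighbour stub is used).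

For the pinned anharmonic chain `pinnedChain ω₂ lam β γ` (all parameters `> 0`), under weak-NESS uniqueness, `T > 0`,
the equilibrium total-current autocorrelation `C` pinned by its defining equation
`C_N(s) = ∫ J_tot · (κ_{s⁺} J_tot) dπ_T` (`J_tot = Σ_i j_i = totalCurrentObs`, `π_T = gibbsMeasure N T`), `N ≥ 2` and
`t ≥ 0`: the time-integrated total current `Φ_t(z, w) = ∫₀ᵗ J_tot(Φ_s(z, B(w))) ds` of the forward process started from
`π_T` is in `L²(π_T ⊗ W)` and `Var(Φ_t) = 2∫₀ᵗ (t - s) C_N(s) ds`.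

Proof (verbatim the pattern of K6a, `LinearResponseFTUR.stub_equilibriumBondHeatVariance`, with the bond current `j_b`
replaced by the total current `J_tot`): uniqueness makes `π_T` invariant for the constructed equal-temperature kernels
(`BondHeatUncertainty.gibbsMeasure_bind_transitionKernel`); `J_tot` is continuous, square integrable under `π_T` (finite
sum of the square-integrable bond currents, `SubdiffusiveBondHeat.pinnedChain_integrable_sq_bondCurrent`) and centred
(`pinnedChain_integral_bondCurrent_gibbsMeasure`); hence `Φ_t` is measurable (parametric interval integral), has mean
`t · π_T(J_tot) = 0` (`LinearResponseFTUR.EquilibriumBondHeatVariance.pinnedChain_integral_intervalIntegral_of_invariant`),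
is in `L²` (`SubdiffusiveBondHeat.pinnedChain_integrable_intervalIntegral_mul_of_invariant`) and has second moment
`2∫₀ᵗ (t - r) ∫ J_tot · (κ_r J_tot) dπ_T dr` (`SubdiffusiveBondHeat.pinnedChain_integral_sq_intervalIntegral_of_invariant`),
which is the right-hand side verbatim; the variance of a centred variable is its second moment
(`ProbabilityTheory.variance_of_integral_eq_zero`).
-/

noncomputable section

namespace Summit.AtomisticToContinuum.FouriersLaw.Theorems.NonBallistic

open MeasureTheory ProbabilityTheory Filter Topology Set
open scoped NNReal ENNReal BigOperators
open Literature.MathematicalPhysics.KineticTheory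
open Literature.MathematicalPhysics.KineticTheory.HeatConduction
open Literature.Probability.Process
open Summit.AtomisticToContinuum.FouriersLaw.Theorems.BondHeatUncertainty
open Summit.AtomisticToContinuum.FouriersLaw.Theorems.SubdiffusiveBondHeat
open Summit.AtomisticToContinuum.FouriersLaw.Theorems.LinearResponseFTUR
open Summit.AtomisticToContinuum.FouriersLaw.Theorems.JunctionLocality
open Summit.AtomisticToContinuum.FouriersLaw.Theorems.NonBallistic.DrudeLine

/-- **Stub `stub_equilibriumTimeIntegratedCurrentVariance`** (= `DrudeLine.EquilibriumTimeIntegratedCurrentVariance`):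
under weak-NESS uniqueness (which makes the Gibbs measure `π_T = gibbsMeasure N T` invariant for the constructed
equal-temperature kernels), for `T > 0`, `C` pinned by its defining equation, `N ≥ 2` and `t ≥ 0`:
`Φ_t ∈ L²(π_T ⊗ W)` and `Var(Φ_t) = 2∫₀ᵗ (t - s) C_N(s) ds` (mean `t · π_T(J_tot) = 0` by momentum parity; second
moment by the two-time law of the stationary flow, `SubdiffusiveBondHeat.pinnedChain_integral_sq_intervalIntegral_of_invariant`
with `f = J_tot`). [folklore] -/
theorem stub_equilibriumTimeIntegratedCurrentVariance :
    ∀ ω₂ lam β γ : ℝ, 0 < ω₂ → 0 < lam → 0 < β → 0 < γ →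
    (∀ (N : ℕ) (T_L T_R : ℝ), 0 < T_L → 0 < T_R → ∀ μ ν : Measure (PhaseSpace N),
      (pinnedChain ω₂ lam β γ).IsSteadyState N T_L T_R μ →
      (pinnedChain ω₂ lam β γ).IsSteadyState N T_L T_R ν → μ = ν) →
    ∀ T : ℝ, 0 < T →
    ∀ C : ℕ → ℝ → ℝ,
      C = (fun (N : ℕ) (s : ℝ) => ∫ x, (∑ i : Fin N, (pinnedChain ω₂ lam β γ).bondCurrent N i x) *
            (∫ y, (∑ i : Fin N, (pinnedChain ω₂ lam β γ).bondCurrent N i y)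
              ∂((pinnedChain ω₂ lam β γ).transitionKernel N T T s.toNNReal x))
            ∂((pinnedChain ω₂ lam β γ).gibbsMeasure N T)) →
    ∀ N : ℕ, 2 ≤ N → ∀ t : ℝ, 0 ≤ t →
      MemLp (timeIntegratedCurrent (pinnedChain ω₂ lam β γ) N T T t) 2
          (((pinnedChain ω₂ lam β γ).gibbsMeasure N T).prod wienerPair) ∧
        variance (timeIntegratedCurrent (pinnedChain ω₂ lam β γ) N T T t)
            (((pinnedChain ω₂ lam β γ).gibbsMeasure N T).prod wienerPair) =
          2 * ∫ s in (0 : ℝ)..t, (t - s) * C N s := by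
  intro ω₂ lam β γ hω hl hβ hγ huniq T hT C hC N hN t ht
  subst hC
  have hinv : ∀ u : ℝ≥0, ((pinnedChain ω₂ lam β γ).gibbsMeasure N T).bind
      ((pinnedChain ω₂ lam β γ).transitionKernel N T T u) = (pinnedChain ω₂ lam β γ).gibbsMeasure N T :=
    fun u => gibbsMeasure_bind_transitionKernel hω hl hβ hγ huniq hN hT u
  haveI hprob : IsProbabilityMeasure ((pinnedChain ω₂ lam β γ).gibbsMeasure N T) :=
    pinnedChain_isProbabilityMeasure_gibbsMeasure hω hl.le hβ.le γ N hT
  -- the total current: continuous, square integrable, mean zero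
  have hjc : Continuous (totalCurrentObs (pinnedChain ω₂ lam β γ) N) :=
    continuous_finsetSum _ fun i _ => pinnedChain_continuous_bondCurrent ω₂ lam β γ N i
  have hjm : Measurable (totalCurrentObs (pinnedChain ω₂ lam β γ) N) := hjc.measurable
  have hji : ∀ i : Fin N, MemLp ((pinnedChain ω₂ lam β γ).bondCurrent N i) 2
      ((pinnedChain ω₂ lam β γ).gibbsMeasure N T) := fun i =>
    (memLp_two_iff_integrable_sq
      (pinnedChain_continuous_bondCurrent ω₂ lam β γ N i).aestronglyMeasurable).2
      (pinnedChain_integrable_sq_bondCurrent hω hl.le hβ.le γ N hT i)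
  have hjL2 : MemLp (totalCurrentObs (pinnedChain ω₂ lam β γ) N) 2 ((pinnedChain ω₂ lam β γ).gibbsMeasure N T) :=
    memLp_finsetSum _ fun i _ => hji i
  have hj2 : Integrable (fun y => totalCurrentObs (pinnedChain ω₂ lam β γ) N y ^ 2)
      ((pinnedChain ω₂ lam β γ).gibbsMeasure N T) :=
    (memLp_two_iff_integrable_sq hjm.aestronglyMeasurable).1 hjL2
  have hj0 : ∫ y, totalCurrentObs (pinnedChain ω₂ lam β γ) N y ∂((pinnedChain ω₂ lam β γ).gibbsMeasure N T) = 0 := by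
    simp only [totalCurrentObs_def]
    rw [integral_finsetSum _ fun i _ => (hji i).integrable one_le_two]
    exact Finset.sum_eq_zero fun i _ => pinnedChain_integral_bondCurrent_gibbsMeasure ω₂ lam β γ N T i
  -- the time-integrated total current `Φ_t` on `Ω = PhaseSpace N × WienerPair`, written out
  have hΦ : timeIntegratedCurrent (pinnedChain ω₂ lam β γ) N T T t =
      fun zw : PhaseSpace N × WienerPair => ∫ s in (0 : ℝ)..t,
        totalCurrentObs (pinnedChain ω₂ lam β γ) N ((pinnedChain ω₂ lam β γ).solMap N T T s zw.1 (pairPath zw.2)) :=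
    rfl
  have hQm : Measurable fun zw : PhaseSpace N × WienerPair => ∫ s in (0 : ℝ)..t,
      totalCurrentObs (pinnedChain ω₂ lam β γ) N ((pinnedChain ω₂ lam β γ).solMap N T T s zw.1 (pairPath zw.2)) := by
    have hsol := fun s : ℝ => pinnedChain_measurable_solMap_pairPath hω hl.le hβ.le hγ.le N T T s
    have hcont := fun zw : PhaseSpace N × WienerPair =>
      pinnedChain_continuous_solMap hω hl.le hβ.le hγ.le N T T zw.1 (pairPath zw.2)
    refine measurable_intervalIntegral_of_continuous_of_measurable
      (u := fun (s : ℝ) (zw : PhaseSpace N × WienerPair) => totalCurrentObs (pinnedChain ω₂ lam β γ) N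
        ((pinnedChain ω₂ lam β γ).solMap N T T s zw.1 (pairPath zw.2)))
      (fun zw => ?_) (fun s => ?_) t
    · have h := hjc.comp (hcont zw)
      exact h
    · have h := hjm.comp (hsol s)
      exact h
  have hQ2 : Integrable (fun zw : PhaseSpace N × WienerPair => (∫ s in (0 : ℝ)..t,
      totalCurrentObs (pinnedChain ω₂ lam β γ) N
        ((pinnedChain ω₂ lam β γ).solMap N T T s zw.1 (pairPath zw.2))) ^ 2)
      (((pinnedChain ω₂ lam β γ).gibbsMeasure N T).prod wienerPair) := by
    have h := pinnedChain_integrable_intervalIntegral_mul_of_invariant hω hl.le hβ.le hγ.le N T T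
      ((pinnedChain ω₂ lam β γ).gibbsMeasure N T) hinv hjm hjm hj2 hj2 ht
    refine h.congr (Eventually.of_forall fun zw => ?_)
    simp only [sq]
  have hmean : ∫ zw, (∫ s in (0 : ℝ)..t, totalCurrentObs (pinnedChain ω₂ lam β γ) N
      ((pinnedChain ω₂ lam β γ).solMap N T T s zw.1 (pairPath zw.2)))
      ∂(((pinnedChain ω₂ lam β γ).gibbsMeasure N T).prod wienerPair) = 0 := by
    rw [EquilibriumBondHeatVariance.pinnedChain_integral_intervalIntegral_of_invariant hω hl.le hβ.le hγ.le
      N T T ((pinnedChain ω₂ lam β γ).gibbsMeasure N T) hinv hjm hj2 ht, hj0, mul_zero]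
  have hsq := pinnedChain_integral_sq_intervalIntegral_of_invariant hω hl.le hβ.le hγ.le N T T
    ((pinnedChain ω₂ lam β γ).gibbsMeasure N T) hinv hjm hj2 ht
  rw [hΦ]
  refine ⟨(memLp_two_iff_integrable_sq hQm.aestronglyMeasurable).2 hQ2, ?_⟩
  rw [variance_of_integral_eq_zero hQm.aemeasurable hmean, hsq]
  simp only [totalCurrentObs_def]

end Summit.AtomisticToContinuum.FouriersLaw.Theorems.NonBallistic

end
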